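import Summits.BirchSwinnertonDyer.BirchSwinnertonDyer.Theorems.KolyvaginRoadThreeHalvesTamAtThreeNormContinuity
import HarnessLib

/-!
# Route `KolyvaginRoadThree`, crux `ValueContinuityAtThree` (item stmt-BirchSwinnertonDyer-19493, the H2 child SHARED
# with route `ClassRecordThree`: child of `HalvesTamAtThree` 19155 here, of `HalvesAtThree` 19107 there) — the two
# routes' decls are ONE statement (`Iff.rfl`), and the by-name suppliers on the Kolyvagin road: crux ⟸ THEOREM C
# typed; crux ⟸ (VN₃) ∧ frames; crux ⟹ the H2 leaf `KolyvaginRoadThree.BDPValueLeafAtThree`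

Cell `bsd-stepL` (run/shared/lean/pub/bsd-stepL/), seat `bsd-stepL-thmc-p1` (prover g4, D-0074 hands, 2026-08-26),
`--supports stmt-BirchSwinnertonDyer-19493`; companion of `Theorems/ClassRecordThreeValueContinuityAtThreeSuppliers.lean`
(same session; the stub-level statements live there, against the registered skeleton, which concludes the
`ClassRecordThree` decl). Everything is a one-line composition of this seat's landed g2/g3 theorems
(`valueContinuity₃_classwide_of_classicalFrameValue`, `valueContinuity₃_of_classicalFrameValue`,
`classicalFrameValue₃_of_normContinuity_of_frames`, `kolyvaginRoadThree_bdpValueLeafAtThree_of_valueContinuity`).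

HONEST FRAMING: implications and one definitional equivalence only; (VC₃), (VN₃) and THEOREM C typed are NOT
discharged, NOT kernel theorems and NOT Literature facts (no print at `3 ∥ N`; memo THEOREM C, PROOF-BDP §20);
nothing is booked; no node, label or census count moves (T7); O2 stays OPEN; BSD(E,3) is proved for no class here.

References: [Castella2018] Camb. J. Math. 6 (2018) = arXiv:1704.06608, Thm. 3.1–3.2 (pp. 8–9); cell memo PROOF-BDP v1.8 §20.
-/

noncomputable section

open scoped Classical Topology

open Filter WeierstrassCurve NumberField IsDedekindDomain Field PowerSeries
  Literature.NumberTheory.EllipticCurves Literature.NumberTheory.EllipticCurves.ModularForms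
  Literature.NumberTheory.EllipticCurves.Rank1Residual
  Literature.NumberTheory.GaloisRepresentations Literature.NumberTheory.GaloisCohomology
  Summit.BirchSwinnertonDyer.Rank1Residual Summit.BirchSwinnertonDyer.Rank1Residual.X11b
  Summit.BirchSwinnertonDyer.Rank1Residual.X11b.AcSelmer
  Summit.BirchSwinnertonDyer.Rank1Residual.X11b.CongruenceLimit
  Summit.BirchSwinnertonDyer.Rank1Residual.X11b.Halves
  Summit.BirchSwinnertonDyer.Rank1Residual.X11b.Three
  Summit.BirchSwinnertonDyer.BirchSwinnertonDyer.Theses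

namespace Summit.BirchSwinnertonDyer.BirchSwinnertonDyer.Theorems

/-! ## §1 One statement on two routes -/

/-- **The shared child is literally one statement**: `KolyvaginRoadThree.ValueContinuityAtThree` and
`ClassRecordThree.ValueContinuityAtThree` (both = item 19493 by dedup) have the same text. [folklore] -/
theorem kolyvaginRoadThree_valueContinuityAtThree_iff_classRecordThree :
    KolyvaginRoadThree.ValueContinuityAtThree ↔ ClassRecordThree.ValueContinuityAtThree :=
  Iff.rfl

/-! ## §2 The crux on the Kolyvagin road ⟸ THEOREM C typed; ⟸ (VN₃) ∧ frames -/

/-- **Crux `KolyvaginRoadThree.ValueContinuityAtThree` ⟸ THEOREM C typed for every curve** (g0's `hC` = `h12` of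
`Three.bdpValueAt₃_of_frameValue` ∀ W), through g2's `valueContinuity₃_classwide_of_classicalFrameValue`, concluding
the ROUTE DECL literally. CONDITIONAL on THEOREM C typed (memo; not kernel, not print at `3 ∥ N`).
[cite: Castella2018, Thm. 3.1–3.2 (arXiv:1704.06608 pp. 8–9) (frame and value shapes only; nothing asserted at p = 3)] -/
theorem kolyvaginRoadThree_valueContinuityAtThree_of_classicalFrameValue
    (hC : ∀ (W : WeierstrassCurve ℚ) [W.IsElliptic] [W.IsGloballyMinimal],
      ∀ (N : ℕ) [NeZero N] (K : Type) [Field K] [NumberField K] (Dt : ModularParametrizationData W N)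
      (H : HeegnerDatum N (NumberField.discr K)) (ι : K →+* ℂ) (P : (W.baseChange K).toAffine.Point),
      ClassX11b W 3 → Surj W 3 → W.conductorNorm ℤ = N → IsImaginaryQuadratic K →
      Odd (NumberField.discr K) → SatisfiesHeegnerHypothesis N K →
      (W.quadraticTwist (NumberField.discr K : ℚ)).entireLFunction 1 ≠ 0 →
      WeierstrassCurve.Affine.Point.map ι.toRatAlgHom P = heegnerPointComplex Dt H →
      ¬ (3 : ℤ) ∣ Dt.c → ¬ IsOfFinAddOrder P →
      ∀ (κ : ZpExtension K 3), κ.IsAnticyclotomic →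
        ∀ (γ : Field.absoluteGaloisGroup K) [Fact (κ.IsTopGenerator γ)]
          (𝔭 : HeightOneSpectrum (𝓞 K)) (h𝔭 : ((3 : ℕ) : 𝓞 K) ∈ 𝔭.asIdeal)
          (he : 𝔭.asIdeal.ramificationIdx (𝓞 ℚ) = 1) (hf : 𝔭.asIdeal.inertiaDeg (𝓞 ℚ) = 1),
          ∀ (f : CuspForm (CongruenceSubgroup.Gamma0 N) 2), IsNewformOf W f →
            ∀ (ι' : PadicAlgCl 3 ≃+* ℂ), InducesPrime ι' 𝔭 →
              ∃ (ΩK : ℂ) (Ωp : (unrIntegers 3)ˣ) (L : UnrSeries 3),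
                ΩK ≠ 0 ∧ IsBDPLFunction ι' 𝔭 κ γ f ΩK ((Ωp : unrIntegers 3) : ℂ_[3]) L ∧
                ∃ u : (unrIntegers 3)ˣ, L.HasValueAt 0 (((u : unrIntegers 3) : ℂ_[3]) *
                  (algebraMap ℚ_[3] ℂ_[3] (((1 : ℚ_[3]) - ((W.LFunction 3 : ℤ) : ℚ_[3]) * (3 : ℚ_[3])⁻¹) *
                    logOmega W 3 (embAt K 3 𝔭 h𝔭 he hf) P)) ^ 2)) :
    KolyvaginRoadThree.ValueContinuityAtThree :=
  valueContinuity₃_classwide_of_classicalFrameValue hC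

/-- **Crux `KolyvaginRoadThree.ValueContinuityAtThree` ⟸ (VN₃) for every curve ∧ frames at every datum and every
`ι'`** (g3's `classicalFrameValue₃_of_normContinuity_of_frames`, then g2's `valueContinuity₃_of_classicalFrameValue`).
CONDITIONAL on both hypotheses. [cite: Castella2018, Thm. 3.1–3.2 (arXiv:1704.06608 pp. 8–9) (shapes only; nothing asserted at p = 3)] -/
theorem kolyvaginRoadThree_valueContinuityAtThree_of_normContinuity_of_frames
    (hVN : ∀ (W : WeierstrassCurve ℚ) [W.IsElliptic] [W.IsGloballyMinimal],
      ∀ (N : ℕ) [NeZero N] (K : Type) [Field K] [NumberField K] (Dt : ModularParametrizationData W N)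
      (H : HeegnerDatum N (NumberField.discr K)) (ι : K →+* ℂ) (P : (W.baseChange K).toAffine.Point),
      ClassX11b W 3 → Surj W 3 → W.conductorNorm ℤ = N → IsImaginaryQuadratic K →
      Odd (NumberField.discr K) → SatisfiesHeegnerHypothesis N K →
      (W.quadraticTwist (NumberField.discr K : ℚ)).entireLFunction 1 ≠ 0 →
      WeierstrassCurve.Affine.Point.map ι.toRatAlgHom P = heegnerPointComplex Dt H →
      ¬ (3 : ℤ) ∣ Dt.c → ¬ IsOfFinAddOrder P →
      ∀ (κ : ZpExtension K 3), κ.IsAnticyclotomic →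
        ∀ (γ : Field.absoluteGaloisGroup K) [Fact (κ.IsTopGenerator γ)]
          (𝔭 : HeightOneSpectrum (𝓞 K)) (h𝔭 : ((3 : ℕ) : 𝓞 K) ∈ 𝔭.asIdeal)
          (he : 𝔭.asIdeal.ramificationIdx (𝓞 ℚ) = 1) (hf : 𝔭.asIdeal.inertiaDeg (𝓞 ℚ) = 1),
          ∀ (f : CuspForm (CongruenceSubgroup.Gamma0 N) 2), IsNewformOf W f →
            ∀ (ι' : PadicAlgCl 3 ≃+* ℂ), InducesPrime ι' 𝔭 →
              ∃ (ΩK : ℂ) (Ωp : ℂ_[3]), ΩK ≠ 0 ∧ Ωp ≠ 0 ∧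
                ∀ (φ : ℕ → HeckeCharacter K) (n : ℕ → ℕ) (r : ℕ → FramedGaloisRep K (PadicAlgCl 3) 1),
                  (∀ k, 0 < n k) → (∀ k (v : HeightOneSpectrum (𝓞 K)), (φ k).IsUnramifiedAt v) →
                  (∀ k, (φ k).HasInfinityType (fun _ ↦ (n k : ℤ)) (fun _ ↦ -(n k : ℤ))) →
                  (∀ k, IsPAdicAvatarOf ι' (φ k) (r k)) → (∀ k, FactorsThroughZp κ (r k)) →
                  Tendsto (fun k ↦ avatarValueAt (r k) γ) atTop (𝓝 1) →
                  Tendsto (fun k ↦ ‖((ι'.symm (bdpInterpolationValue 3 f 𝔭 (φ k) (n k) ΩK) :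
                    PadicAlgCl 3) : ℂ_[3]) * Ωp ^ (4 * n k)‖) atTop
                    (𝓝 (‖algebraMap ℚ_[3] ℂ_[3] (((1 : ℚ_[3]) - ((W.LFunction 3 : ℤ) : ℚ_[3]) *
                        (3 : ℚ_[3])⁻¹) * logOmega W 3 (embAt K 3 𝔭 h𝔭 he hf) P)‖ ^ 2)))
    (hF : ∀ (W : WeierstrassCurve ℚ) [W.IsElliptic] [W.IsGloballyMinimal],
      ∀ (N : ℕ) [NeZero N] (K : Type) [Field K] [NumberField K] (Dt : ModularParametrizationData W N)
      (H : HeegnerDatum N (NumberField.discr K)) (ι : K →+* ℂ) (P : (W.baseChange K).toAffine.Point),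
      ClassX11b W 3 → Surj W 3 → W.conductorNorm ℤ = N → IsImaginaryQuadratic K →
      Odd (NumberField.discr K) → SatisfiesHeegnerHypothesis N K →
      (W.quadraticTwist (NumberField.discr K : ℚ)).entireLFunction 1 ≠ 0 →
      WeierstrassCurve.Affine.Point.map ι.toRatAlgHom P = heegnerPointComplex Dt H →
      ¬ (3 : ℤ) ∣ Dt.c → ¬ IsOfFinAddOrder P →
      ∀ (κ : ZpExtension K 3), κ.IsAnticyclotomic →
        ∀ (γ : Field.absoluteGaloisGroup K) [Fact (κ.IsTopGenerator γ)]
          (𝔭 : HeightOneSpectrum (𝓞 K)) (h𝔭 : ((3 : ℕ) : 𝓞 K) ∈ 𝔭.asIdeal)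
          (he : 𝔭.asIdeal.ramificationIdx (𝓞 ℚ) = 1) (hf : 𝔭.asIdeal.inertiaDeg (𝓞 ℚ) = 1),
          ∀ (f : CuspForm (CongruenceSubgroup.Gamma0 N) 2), IsNewformOf W f →
            ∀ (ι' : PadicAlgCl 3 ≃+* ℂ), InducesPrime ι' 𝔭 →
              ∃ (ΩK : ℂ) (Ωp : (unrIntegers 3)ˣ) (L : UnrSeries 3),
                ΩK ≠ 0 ∧ IsBDPLFunction ι' 𝔭 κ γ f ΩK ((Ωp : unrIntegers 3) : ℂ_[3]) L) :
    KolyvaginRoadThree.ValueContinuityAtThree :=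
  fun W _ _ ↦ valueContinuity₃_of_classicalFrameValue
    (classicalFrameValue₃_of_normContinuity_of_frames (hVN W) (hF W))

/-! ## §3 What the crux gives on the Kolyvagin road -/

/-- **Crux 19493 ⟹ the Kolyvagin road's H2 leaf `KolyvaginRoadThree.BDPValueLeafAtThree`** (item 19406, shared), by
name (g3's `kolyvaginRoadThree_bdpValueLeafAtThree_of_valueContinuity`).
[cite: Castella2018, Thm. 3.2 (arXiv:1704.06608 p. 9) (value shape only; nothing asserted at p = 3)] -/
theorem kolyvaginRoadThree_bdpValueLeafAtThree_of_valueContinuityAtThree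
    (h : KolyvaginRoadThree.ValueContinuityAtThree) : KolyvaginRoadThree.BDPValueLeafAtThree :=
  kolyvaginRoadThree_bdpValueLeafAtThree_of_valueContinuity h

/-- **Crux ⟹ (VN₃) for every curve, read on the Kolyvagin road** (take norms, g3's `normContinuity₃_of_valueContinuity`).
[cite: Castella2018, Thm. 3.1 (arXiv:1704.06608 p. 9) (display shape only)] -/
theorem normContinuity₃_classwide_of_kolyvaginRoadThree_valueContinuityAtThree
    (h : KolyvaginRoadThree.ValueContinuityAtThree) :
    ∀ (W : WeierstrassCurve ℚ) [W.IsElliptic] [W.IsGloballyMinimal],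
    ∀ (N : ℕ) [NeZero N] (K : Type) [Field K] [NumberField K] (Dt : ModularParametrizationData W N)
    (H : HeegnerDatum N (NumberField.discr K)) (ι : K →+* ℂ) (P : (W.baseChange K).toAffine.Point),
    ClassX11b W 3 → Surj W 3 → W.conductorNorm ℤ = N → IsImaginaryQuadratic K →
    Odd (NumberField.discr K) → SatisfiesHeegnerHypothesis N K →
    (W.quadraticTwist (NumberField.discr K : ℚ)).entireLFunction 1 ≠ 0 →
    WeierstrassCurve.Affine.Point.map ι.toRatAlgHom P = heegnerPointComplex Dt H →
    ¬ (3 : ℤ) ∣ Dt.c → ¬ IsOfFinAddOrder P →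
    ∀ (κ : ZpExtension K 3), κ.IsAnticyclotomic →
      ∀ (γ : Field.absoluteGaloisGroup K) [Fact (κ.IsTopGenerator γ)]
        (𝔭 : HeightOneSpectrum (𝓞 K)) (h𝔭 : ((3 : ℕ) : 𝓞 K) ∈ 𝔭.asIdeal)
        (he : 𝔭.asIdeal.ramificationIdx (𝓞 ℚ) = 1) (hf : 𝔭.asIdeal.inertiaDeg (𝓞 ℚ) = 1),
        ∀ (f : CuspForm (CongruenceSubgroup.Gamma0 N) 2), IsNewformOf W f →
          ∀ (ι' : PadicAlgCl 3 ≃+* ℂ), InducesPrime ι' 𝔭 →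
            ∃ (ΩK : ℂ) (Ωp : ℂ_[3]), ΩK ≠ 0 ∧ Ωp ≠ 0 ∧
              ∀ (φ : ℕ → HeckeCharacter K) (n : ℕ → ℕ) (r : ℕ → FramedGaloisRep K (PadicAlgCl 3) 1),
                (∀ k, 0 < n k) → (∀ k (v : HeightOneSpectrum (𝓞 K)), (φ k).IsUnramifiedAt v) →
                (∀ k, (φ k).HasInfinityType (fun _ ↦ (n k : ℤ)) (fun _ ↦ -(n k : ℤ))) →
                (∀ k, IsPAdicAvatarOf ι' (φ k) (r k)) → (∀ k, FactorsThroughZp κ (r k)) →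
                Tendsto (fun k ↦ avatarValueAt (r k) γ) atTop (𝓝 1) →
                Tendsto (fun k ↦ ‖((ι'.symm (bdpInterpolationValue 3 f 𝔭 (φ k) (n k) ΩK) :
                  PadicAlgCl 3) : ℂ_[3]) * Ωp ^ (4 * n k)‖) atTop
                  (𝓝 (‖algebraMap ℚ_[3] ℂ_[3] (((1 : ℚ_[3]) - ((W.LFunction 3 : ℤ) : ℚ_[3]) *
                      (3 : ℚ_[3])⁻¹) * logOmega W 3 (embAt K 3 𝔭 h𝔭 he hf) P)‖ ^ 2)) :=
  fun W _ _ ↦ normContinuity₃_of_valueContinuity (h W)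

end Summit.BirchSwinnertonDyer.BirchSwinnertonDyer.Theorems

end
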